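import Summits.QuantumFields.BalabanUV.T4Continuum.Support.VariationalColourTaxiTower

/-!
# T⁴ programme, spine node NE2 (U1a), lane P2 — «V-COL-TAXI-TOWER», part 2: RUNS PAST TAXIS — a straight run of `L·t` bonds commutes with a taxi up to
# `(d−1)·L t·(L−1)·a` (part «V-COL-TAXI» 1's `L`-run lemma with a run of any whole number of blocks), the building block of invariant (E_k)

NE2 formalisation swarm `b2b-balaban-t4-ne2-formalise-*`, leaf prover 04 GEN 4 (`prover-b2b-balaban-t4-ne2-formalise-leaf-04-g4-0`); register row «P2-sup» of
`t4/formal/NE2/LEAVES.md`; journal CLAIMS.log «V-COL-TAXI-TOWER».  On top of part 1 (`Rlev`, `nestLv`, telescoping) and «V-COL-TAXI» part 1 (`taxiAcc`, `legTv`,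
`corner_next`, `norm_piTv_comm_sub_le` BY NAME).
 * §1 `corner_add_tstep` ∕ `bpt_add_tstep_mul` (translates by `(L·t) e_μ`), `piTv_coarseTv_eq` (`t` coarse bonds `coarseTv S` from a site = `L·t` fine bonds of `S`
   from its base point — the level-`k` runs read one level down), **`run_mul_taxiAcc_sub_le`**:
   `‖Π^μ_{L·t}(L·y) ∘ taxiAcc R′ (y + t e_μ) j k − taxiAcc R′ y j k ∘ Π^μ_{L·t}(corner y j k)‖ ≤ #{i<k, i≠μ}·(L t)·(L−1)·a` — each leg `i ≠ μ` is an `(L t) × j_i`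
   rectangle, the leg `i = μ` commutes exactly (`piTv_add`).
WHAT IS NOT HERE (stated, not hidden): the leg-merging lemma and invariant (E_k) itself (part 3), the END.

HONEST FRAMING (T4-DAG p. 1).  Ordered-product bookkeeping at MODEL level (bond operators DATA; taxi ∕ straight contours OURS; SHAPES only, no B0, c5); [folklore];
nothing printed is a hypothesis; no `def`, no `def … : Prop`, no `sorry`; axioms standard.  NE2 NOT proved on either road; NE3 OPEN; spine PROVED 0∕9 unchanged; rung (B)+1
finite T⁴ — NOT infinite volume, NOT mass gap, NOT Clay.  HONEST DEPENDENCY (cell, verbatim): continuum YM on T⁴ ⇐ BetaPertH ∧ nine spine estimates (0/9 proved);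
BetaPertH ⇐ (D1) ∧ (D4) ∧ CAP+tail; G-an2-4 gates asym, D1 and NE2/3/4.
-/

noncomputable section

namespace Summit.QuantumFields.BalabanUV.T4Continuum.VariationalColourTaxiTransport

open Literature.MathematicalPhysics.QuantumFieldTheory.Balaban1983to89.B5Prop11Plancherel (Tor fine unitVec)
open Literature.MathematicalPhysics.QuantumFieldTheory.Balaban1983to89.B5Block118 (tstep tstep_zero tstep_succ bpt bpt_add_tstep)
open Summit.QuantumFields.BalabanUV.T4Continuum.VariationalTaxiTransport (corner corner_succ)
open Summit.QuantumFields.BalabanUV.T4Continuum.VariationalTaxiCoarse (corner_zero corner_next)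
open Summit.QuantumFields.BalabanUV.T4Continuum.VariationalColourFederbush (piTv norm_piTv_le_one)
open Summit.QuantumFields.BalabanUV.T4Continuum.VariationalVectorFederbush (norm_piTv_comm_sub_le)

variable {d : ℕ} {E : Type*} [NormedAddCommGroup E] [NormedSpace ℂ E]
variable (L : ℕ) [NeZero L] (N : Fin d → ℕ) [hN : ∀ μ, NeZero (N μ)]

/-! ## §1 A run of whole blocks past a taxi -/

omit hN in
/-- the corners over the block `t` steps along `μ` are the translates by `(L·t) e_μ`. [folklore] -/
theorem corner_add_tstep (y : Tor N) (j : Fin d → Fin L) (μ : Fin d) (i : ℕ) :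
    ∀ t : ℕ, corner L N (y + tstep N μ t) j i = corner L N y j i + tstep (fine L N) μ (L * t)
  | 0 => by simp [tstep_zero]
  | t + 1 => by
    rw [tstep_succ, ← add_assoc, corner_next, corner_add_tstep y j μ i t, add_assoc, ← VectorBlockTrialForm.tstep_add, Nat.mul_succ]

omit [NeZero L] hN in
/-- block points over the block `t` steps along `μ` are the translates by `(L·t) e_μ`. [folklore] -/
theorem bpt_add_tstep_mul (y : Tor N) (j : Fin d → Fin L) (μ : Fin d) :
    ∀ t : ℕ, bpt L N (y + tstep N μ t) j = bpt L N y j + tstep (fine L N) μ (L * t)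
  | 0 => by simp [tstep_zero]
  | t + 1 => by
    rw [tstep_succ, ← add_assoc, ← bpt_add_tstep, bpt_add_tstep_mul y j μ t, add_assoc, ← VectorBlockTrialForm.tstep_add, Nat.mul_succ]

section CoarseRuns

variable (n : ℕ) [NeZero n] (M : Fin d → ℕ) [hM : ∀ μ, NeZero (M μ)]

omit hM [NeZero n] in
/-- **A STRAIGHT PRODUCT OF COARSE BONDS IS A STRAIGHT RUN OF FINE BONDS**: `t` bonds of the straight coarsening `coarseTv S` from the site `z` = `L·t` bonds of `S`
from the base point `L·z` (`piTv_add`) — the level-`k` runs of the nested carriers read one level down. [folklore] -/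
theorem piTv_coarseTv_eq (S : Tor (fine L (fine n M)) → Fin d → (E →L[ℂ] E)) (z : Tor (fine n M)) (μ : Fin d) :
    ∀ t : ℕ, piTv n M (coarseTv L (fine n M) S) z μ t = piTv L (fine n M) S (bpt L (fine n M) z 0) μ (L * t)
  | 0 => by simp [piTv]
  | t + 1 => by
    rw [Nat.mul_succ, piTv_add L (fine n M) S (bpt L (fine n M) z 0) μ (L * t) L, ← piTv_coarseTv_eq S z μ t]
    simp only [piTv, coarseTv, bpt_add_tstep_mul]

end CoarseRuns

variable {R' : Tor (fine L N) → Fin d → (E →L[ℂ] E)} (hR' : ∀ x μ, ‖R' x μ‖ ≤ 1) {a : ℝ}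
  (ha : ∀ x κ ι, ‖R' x κ * R' (x + unitVec (fine L N) κ) ι - R' x ι * R' (x + unitVec (fine L N) ι) κ‖ ≤ a)
include hR' ha

omit hN in
/-- **A RUN OF `L·t` BONDS ACROSS THE FIRST `k` LEGS**: `‖Π^μ_{L·t}(L·y) ∘ taxiAcc R′ (y + t e_μ) j k − taxiAcc R′ y j k ∘ Π^μ_{L·t}(corner y j k)‖ ≤ #{i < k, i ≠ μ}·(L t)·(L−1)·a`
(«V-COL-TAXI» part 1's `coarse_mul_taxiAcc_sub_le` is the case `t = 1`). [folklore] -/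
theorem run_mul_taxiAcc_sub_le (y : Tor N) (j : Fin d → Fin L) (μ : Fin d) (t : ℕ) {k : ℕ} (hkd : k ≤ d) :
    ‖piTv L N R' (bpt L N y 0) μ (L * t) * taxiAcc L N R' (y + tstep N μ t) j k - taxiAcc L N R' y j k * piTv L N R' (corner L N y j k) μ (L * t)‖
      ≤ ((k - (if (μ : ℕ) < k then 1 else 0) : ℕ) : ℝ) * (((L : ℝ) * t) * ((L - 1 : ℕ) : ℝ) * a) := by
  have ha0 : 0 ≤ a := (norm_nonneg _).trans (ha (corner L N y j 0) μ μ)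
  induction k with
  | zero => simp [taxiAcc, corner_zero]
  | succ k ih =>
    have hkd' : k < d := Nat.lt_of_succ_le hkd
    have ih' := ih hkd'.le
    set c := corner L N y j k with hc
    have hleg : legTv L N R' y j k = piTv L N R' c ⟨k, hkd'⟩ (j ⟨k, hkd'⟩ : ℕ) := by simp [legTv, dif_pos hkd', hc]
    have hleg' : legTv L N R' (y + tstep N μ t) j k = piTv L N R' (c + tstep (fine L N) μ (L * t)) ⟨k, hkd'⟩ (j ⟨k, hkd'⟩ : ℕ) := by
      simp [legTv, dif_pos hkd', hc, corner_add_tstep]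
    have hsucc : corner L N y j (k + 1) = c + tstep (fine L N) ⟨k, hkd'⟩ (j ⟨k, hkd'⟩ : ℕ) := corner_succ L N y j hkd'
    -- the leg term: a rectangle if `k ≠ μ`, exact commutation if `k = μ`
    have hlegterm : ‖piTv L N R' c μ (L * t) * piTv L N R' (c + tstep (fine L N) μ (L * t)) ⟨k, hkd'⟩ (j ⟨k, hkd'⟩ : ℕ)
          - piTv L N R' c ⟨k, hkd'⟩ (j ⟨k, hkd'⟩ : ℕ) * piTv L N R' (c + tstep (fine L N) ⟨k, hkd'⟩ (j ⟨k, hkd'⟩ : ℕ)) μ (L * t)‖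
        ≤ (if (⟨k, hkd'⟩ : Fin d) = μ then 0 else 1) * (((L : ℝ) * t) * ((L - 1 : ℕ) : ℝ) * a) := by
      split_ifs with hkμ
      · rw [hkμ, ← piTv_add, ← piTv_add, add_comm, sub_self, norm_zero, zero_mul]
      · rw [one_mul]
        refine (norm_piTv_comm_sub_le L N hR' ha c μ ⟨k, hkd'⟩ (L * t) (j ⟨k, hkd'⟩ : ℕ)).trans ?_
        have hjk : ((j ⟨k, hkd'⟩ : ℕ) : ℝ) ≤ ((L - 1 : ℕ) : ℝ) := by exact_mod_cast Nat.le_sub_one_of_lt (j ⟨k, hkd'⟩).is_lt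
        have hLt : (0 : ℝ) ≤ (L : ℝ) * t := by positivity
        push_cast
        nlinarith [mul_nonneg hLt ha0]
    -- the count bookkeeping
    have hcnt : ((k + 1 - (if (μ : ℕ) < k + 1 then 1 else 0) : ℕ) : ℝ)
        = ((k - (if (μ : ℕ) < k then 1 else 0) : ℕ) : ℝ) + (if (⟨k, hkd'⟩ : Fin d) = μ then 0 else 1) := by
      by_cases hkμ : (⟨k, hkd'⟩ : Fin d) = μ
      · have hk : k = (μ : ℕ) := by rw [← hkμ]
        rw [if_pos hkμ, hk]; simp
      · have hk : k ≠ (μ : ℕ) := fun e => hkμ (Fin.ext e)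
        rw [if_neg hkμ]
        by_cases hlt : (μ : ℕ) < k
        · rw [if_pos hlt, if_pos (Nat.lt_succ_of_lt hlt), show k + 1 - 1 = (k - 1) + 1 by omega]; push_cast; ring
        · have hgt : k < (μ : ℕ) := lt_of_le_of_ne (not_lt.mp hlt) hk
          rw [if_neg hlt, if_neg (by omega), Nat.sub_zero, Nat.sub_zero]; push_cast; ring
    -- insert `taxiAcc k ∘ Π^μ_{Lt}(c) ∘ leg′ k`
    have e : piTv L N R' (bpt L N y 0) μ (L * t) * taxiAcc L N R' (y + tstep N μ t) j (k + 1)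
          - taxiAcc L N R' y j (k + 1) * piTv L N R' (corner L N y j (k + 1)) μ (L * t)
        = (piTv L N R' (bpt L N y 0) μ (L * t) * taxiAcc L N R' (y + tstep N μ t) j k - taxiAcc L N R' y j k * piTv L N R' c μ (L * t))
            * legTv L N R' (y + tstep N μ t) j k
          + taxiAcc L N R' y j k * (piTv L N R' c μ (L * t) * piTv L N R' (c + tstep (fine L N) μ (L * t)) ⟨k, hkd'⟩ (j ⟨k, hkd'⟩ : ℕ)
              - piTv L N R' c ⟨k, hkd'⟩ (j ⟨k, hkd'⟩ : ℕ) * piTv L N R' (c + tstep (fine L N) ⟨k, hkd'⟩ (j ⟨k, hkd'⟩ : ℕ)) μ (L * t)) := by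
      rw [hsucc]
      simp only [taxiAcc, hleg', hleg, sub_mul, mul_sub, mul_assoc]; abel
    rw [e, hcnt, add_mul]
    refine (norm_add_le _ _).trans (add_le_add ((norm_mul_le _ _).trans ?_) ((norm_mul_le _ _).trans ?_))
    · exact (mul_le_mul ih' (norm_legTv_le_one L N hR' _ j k) (norm_nonneg _) (by positivity)).trans_eq (mul_one _)
    · exact (mul_le_mul (norm_taxiAcc_le_one L N hR' y j k) hlegterm (norm_nonneg _) zero_le_one).trans_eq (one_mul _)

omit hN in
/-- the full taxi: `‖Π^μ_{L·t}(L·y) ∘ taxiAcc R′ (y + t e_μ) j d − taxiAcc R′ y j d ∘ Π^μ_{L·t}(L·y + j)‖ ≤ (d−1)·(L t)·(L−1)·a`. [folklore] -/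
theorem run_mul_taxiAcc_sub_le_d (y : Tor N) (j : Fin d → Fin L) (μ : Fin d) (t : ℕ) :
    ‖piTv L N R' (bpt L N y 0) μ (L * t) * taxiAcc L N R' (y + tstep N μ t) j d - taxiAcc L N R' y j d * piTv L N R' (bpt L N y j) μ (L * t)‖
      ≤ ((d - 1 : ℕ) : ℝ) * (((L : ℝ) * t) * ((L - 1 : ℕ) : ℝ) * a) := by
  have h := run_mul_taxiAcc_sub_le L N hR' ha y j μ t le_rfl
  rwa [if_pos μ.is_lt, VariationalTaxiTransport.corner_d] at h

end Summit.QuantumFields.BalabanUV.T4Continuum.VariationalColourTaxiTransport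

end
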